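import Summits.PneNP.PneNP.Theorems.ClusUniversalCertificateCoordInv
import Mathlib
import HarnessLib

/-!
# Route ClusUniversalCertificate — path `coord` on the crux `UniversalCertAll` (stmt-PneNP-19683): block transvections are BZP
(rung F-N1, cell pnp-ideate, planner p1 g6; registered skeleton HOME/pnp-ideate-p1/lines/layer.lean v8 sha16 f469cf6a, path `coord`, card lines/coord.md:
«by GL(block)-invariance the deleted direction may be ANY nonzero vector `v` of a block, `W_v = #{y : y|_{B_k} = v}`»)

HELPER (no registered stub; supports stmt-PneNP-19683): the card's remark made kernel-usable.  For a block `k`, a coordinate `i₀` of block `k` and a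
vector `v` supported in block `k` with `v_{i₀} = 1`, the TRANSVECTION `x ↦ x + x_{i₀}·(v + e_{i₀})` is a linear involution of `𝔽₂^M` that preserves
every block-zero pattern (`BZP`) and swaps `v` with `e_{i₀}` (`exists_bzp_swap_single`); under it the unit-vector count `wcount blk i₀` of the image
is the number of points of `Y` whose block `k` equals `v` (`wcount_image_transvection`).  Consequently a ZERO-RARE set (`GZeroRare`: `0` strictly the
rarest block value in every admissible frame) has, in EVERY block, every nonzero supported vector `v` strictly more frequent than `0`
(`card_block_eq_gt_zcount_of_gZeroRare`) — the form in which the hypothesis of the conjecture `stub_peelZeroRare` is used on paper.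

HONEST FRAMING: infrastructure only (M-sized linear algebra over `𝔽₂`) for an OPEN crux of route ClusUniversalCertificate; the load-bearing stub
`stub_peelZeroRare` is OPEN and XL; FRONTIER rung F-N1 — nothing here bears on P vs NP.
-/

set_option linter.dupNamespace false -- `Summit.PneNP.PneNP.…`: summit = sub-problem name (D-0017 single-conjunct layout)

-- BEGIN BODY
namespace Summit.PneNP.PneNP.Theorems.ClusCoord

open Finset

variable {M n : ℕ}

/-- **Block transvection.** For `i₀` in block `k` and `v` supported in block `k` with `v i₀ = 1` there is a block-zero-preserving linear
automorphism `g` of `𝔽₂^M` with `g v = e_{i₀}`, `g e_{i₀} = v`, acting as `g x = x + x_{i₀}·(v + e_{i₀})`. -/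
theorem exists_bzp_swap_single (blk : Fin M → Fin n) (k : Fin n) (i₀ : Fin M) (hi₀ : blk i₀ = k) (v : Fin M → ZMod 2)
    (hv₀ : v i₀ = 1) (hvs : ∀ i, blk i ≠ k → v i = 0) :
    ∃ g : (Fin M → ZMod 2) ≃ₗ[ZMod 2] (Fin M → ZMod 2), BZP blk g ∧
      (∀ x : Fin M → ZMod 2, g x = x + x i₀ • (v + Pi.single i₀ 1)) ∧ g v = Pi.single i₀ 1 ∧ g (Pi.single i₀ 1) = v := by
  classical
  set u : Fin M → ZMod 2 := v + Pi.single i₀ 1 with hu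
  -- the linear map `x ↦ x + x_{i₀} • u`
  let T : (Fin M → ZMod 2) →ₗ[ZMod 2] (Fin M → ZMod 2) :=
    LinearMap.id + (LinearMap.proj i₀ : (Fin M → ZMod 2) →ₗ[ZMod 2] ZMod 2).smulRight u
  have hT : ∀ x : Fin M → ZMod 2, T x = x + x i₀ • u := fun x => rfl
  have hui₀ : u i₀ = 0 := by
    rw [hu, Pi.add_apply, hv₀, Pi.single_eq_same]
    decide
  have hTi₀ : ∀ x : Fin M → ZMod 2, T x i₀ = x i₀ := by
    intro x
    rw [hT, Pi.add_apply, Pi.smul_apply, hui₀, smul_zero, add_zero]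
  have hself : ∀ w : Fin M → ZMod 2, w + w = 0 := fun w => by
    funext j
    exact CharTwo.add_self_eq_zero (w j)
  have huu : u + u = 0 := hself u
  have hinv : Function.Involutive T := by
    intro x
    rw [hT (T x), hTi₀, hT, add_assoc, ← smul_add, huu, smul_zero, add_zero]
  refine ⟨LinearEquiv.ofInvolutive T hinv, ?_, ?_, ?_, ?_⟩
  · -- block-zero patterns are preserved
    intro y j
    change (∀ i, blk i = j → T y i = 0) ↔ (∀ i, blk i = j → y i = 0)
    have hcoord : ∀ i, T y i = y i + y i₀ * u i := fun i => by rw [hT]; rfl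
    by_cases hjk : j = k
    · subst hjk
      constructor
      · intro h i hi
        have h0 : y i₀ = 0 := by rw [← hTi₀ y]; exact h i₀ hi₀
        have := h i hi
        rwa [hcoord, h0, zero_mul, add_zero] at this
      · intro h i hi
        rw [hcoord, h i hi, h i₀ hi₀, zero_mul, add_zero]
    · have huj : ∀ i, blk i = j → u i = 0 := by
        intro i hi
        have hik : blk i ≠ k := by rw [hi]; exact hjk
        have hii₀ : i ≠ i₀ := fun h => hik (h ▸ hi₀)
        rw [hu, Pi.add_apply, hvs i hik, Pi.single_eq_of_ne hii₀, add_zero]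
      constructor
      · intro h i hi
        have := h i hi
        rwa [hcoord, huj i hi, mul_zero, add_zero] at this
      · intro h i hi
        rw [hcoord, h i hi, huj i hi, mul_zero, add_zero]
  · intro x; rfl
  · change T v = Pi.single i₀ 1
    rw [hT, hv₀, one_smul, hu, ← add_assoc, hself v, zero_add]
  · change T (Pi.single i₀ 1) = v
    rw [hT, Pi.single_eq_same, one_smul, hu, add_comm v, ← add_assoc, hself (Pi.single i₀ 1), zero_add]

/-- Under the block transvection swapping `v` and `e_{i₀}`, the points of the image whose block `k` is `e_{i₀}` are exactly the images of the
points of `Y` whose block `k` is `v`. -/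
theorem wcount_image_transvection (blk : Fin M → Fin n) (k : Fin n) (i₀ : Fin M) (hi₀ : blk i₀ = k) (v : Fin M → ZMod 2)
    (hv₀ : v i₀ = 1) (g : (Fin M → ZMod 2) ≃ₗ[ZMod 2] (Fin M → ZMod 2))
    (hg : ∀ x : Fin M → ZMod 2, g x = x + x i₀ • (v + Pi.single i₀ 1)) (Y : Finset (Fin M → ZMod 2)) :
    wcount blk i₀ (Y.image fun y => g y) = (Y.filter fun y => ∀ i, blk i = k → y i = v i).card := by
  classical
  unfold wcount
  rw [Finset.filter_image, Finset.card_image_of_injective _ g.injective]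
  congr 1
  apply Finset.filter_congr
  intro y _
  have hcoord : ∀ i, g y i = y i + y i₀ * (v i + Pi.single (M := fun _ => ZMod 2) i₀ 1 i) := fun i => by rw [hg]; rfl
  have hgi₀ : g y i₀ = y i₀ := by
    rw [hcoord, hv₀, Pi.single_eq_same]
    have : (1 : ZMod 2) + 1 = 0 := by decide
    rw [this, mul_zero, add_zero]
  rw [hi₀]
  constructor
  · rintro ⟨h1, h0⟩
    have hy₀ : y i₀ = 1 := by rw [← hgi₀]; exact h1
    intro i hi
    by_cases hii : i = i₀
    · subst hii; rw [hy₀, hv₀]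
    · have := h0 i hi hii
      rw [hcoord, hy₀, one_mul, Pi.single_eq_of_ne hii, add_zero] at this
      -- `y i + v i = 0` in `𝔽₂`
      have h2 := CharTwo.add_self_eq_zero (v i)
      calc y i = y i + (v i + v i) := by rw [h2, add_zero]
        _ = (y i + v i) + v i := by ring
        _ = v i := by rw [this, zero_add]
  · intro h
    have hy₀ : y i₀ = 1 := by rw [h i₀ hi₀, hv₀]
    refine ⟨by rw [hgi₀, hy₀], ?_⟩
    intro i hi hii
    rw [hcoord, hy₀, one_mul, h i hi, Pi.single_eq_of_ne hii, add_zero]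
    exact CharTwo.add_self_eq_zero (v i)

/-- **Zero-rare in every direction.** If `Y` is zero-rare (`GZeroRare`), then in every block `k` every vector `v` supported in block `k` with some
coordinate `v_{i₀} = 1` is strictly more frequent, as the value of block `k`, than `0`. -/
theorem card_block_eq_gt_zcount_of_gZeroRare (blk : Fin M → Fin n) (Y : Finset (Fin M → ZMod 2)) (hY : GZeroRare blk Y)
    (k : Fin n) (i₀ : Fin M) (hi₀ : blk i₀ = k) (v : Fin M → ZMod 2) (hv₀ : v i₀ = 1) (hvs : ∀ i, blk i ≠ k → v i = 0) :
    zcount blk k Y < (Y.filter fun y => ∀ i, blk i = k → y i = v i).card := by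
  obtain ⟨g, hg, hgx, -, -⟩ := exists_bzp_swap_single blk k i₀ hi₀ v hv₀ hvs
  have h := hY g hg i₀
  rw [hi₀, zcount_image_eq blk g hg k Y, wcount_image_transvection blk k i₀ hi₀ v hv₀ g hgx Y] at h
  exact h

end Summit.PneNP.PneNP.Theorems.ClusCoord
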